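import Summits.QuantumFields.YangMills.Theorems.TwistExponentGapPairRigidityAdFixed
import Literature.MathematicalPhysics.QuantumFieldTheory.ConstructiveQFTWave0
import HarnessLib

/-!
# Finite gauge stabiliser ⇒ no covariantly constant Lie-algebra section (`h⁰ = 0`, Stokes-free form)
# (route-independent helper toward the crux `TwistExponentGap.RigidTwistCeiling` ⟨stmt-QuantumFields-24054⟩; free hands of
# width seat ym-line-sfw-p2-w3)

The hypothesis `h0` of `lattice_cocycle_exact` (`TwistExponentGapLatticeCocycle`: `h⁰ = 0 ⇒ h¹ = 0` on the discrete torus) asks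
that the adjoint lattice connection `A(e) = Ad ρ(U₀ e)` of the configuration `U₀` have no non-zero covariantly constant section.
This file derives that from the GROUP-level statement «the lattice gauge stabiliser `{g | g · U₀ = U₀}` of `U₀` is finite»
(`covConst_eq_zero_of_finite_stabilizer`), with no lattice Stokes theorem: a covariantly constant `𝔤_ρ`-valued section `F`
(`ρ(U₀ e)·F(x+e_μ) = F(x)·ρ(U₀ e)`, `exp(ℝ F(x)) ⊆ ρ(G)`) exponentiates to a one-parameter family `g_t(x) = ρ⁻¹ exp(t F(x))`
of gauge transformations FIXING `U₀` (`exp` intertwines semiconjugation: `SemiconjBy.exp_right`), so `t ↦ exp(t F(x))` takes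
finitely many values and `F(x) = 0` by `eq_zero_of_exp_smul_mem_finite` (✓ `TwistExponentGapPairRigidityAdFixed`).
What is left between the crux's pair-rigidity and this file's hypothesis: for a `z`-twisted-flat `U₀` a stabiliser `g` is
determined by `g(x₀)` (parallel transport) and `g(x₀)` centralises the two holonomies of `U₀` along the cycles of the twisted
plane through `x₀`, whose commutator is `z^{±1}` (exactly one twisted plaquette per slice — lattice Stokes on the `S × S` torus
slice, NOT proved here); pair-rigidity then makes the stabiliser finite.
HONEST FRAMING: elementary; nothing here bears on a summit statement or on the Yang–Mills mass gap.
-/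

set_option autoImplicit false

noncomputable section

open scoped Matrix.Norms.Frobenius
open NormedSpace
open Literature.MathematicalPhysics.QuantumFieldTheory

namespace Summit.QuantumFields.YangMills.Theorems.TwistExponentGap

/-- `exp` intertwines a semiconjugation (`SemiconjBy.exp_right`): if `ρ(u)·Y = X·ρ(u)` then `ρ(u)·exp(tY) = exp(tX)·ρ(u)`. -/
theorem rho_mul_exp_smul_eq {G : Type*} [Group G] {N : ℕ} (ρ : G →* Matrix (Fin N) (Fin N) ℂ) (u : G)
    {X Y : Matrix (Fin N) (Fin N) ℂ} (h : ρ u * Y = X * ρ u) (t : ℝ) :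
    ρ u * exp (t • Y) = exp (t • X) * ρ u := by
  have hs : SemiconjBy (ρ u) Y X := h
  exact (hs.smul_right t).exp_right

/-- **Finite gauge stabiliser ⇒ `h⁰ = 0`.**  For a faithful matrix representation `ρ` and a lattice configuration `U₀` whose
gauge stabiliser `{g | gaugeTransform g U₀ = U₀}` is finite, every `𝔤_ρ`-valued section `F` (`exp(ℝ F(x)) ⊆ ρ(G)`) that is
covariantly constant for the adjoint connection (`ρ(U₀(x,μ))·F(x + e_μ) = F(x)·ρ(U₀(x,μ))`) vanishes. -/
theorem covConst_eq_zero_of_finite_stabilizer {G : Type*} [Group G] {N d S : ℕ} (ρ : G →* Matrix (Fin N) (Fin N) ℂ)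
    (hinj : Function.Injective ρ) (U₀ : GaugeConfig d S G)
    (hfin : Set.Finite {g : Site d S → G | gaugeTransform g U₀ = U₀})
    (F : Site d S → Matrix (Fin N) (Fin N) ℂ) (hF : ∀ (x : Site d S) (t : ℝ), exp (t • F x) ∈ Set.range ρ)
    (hcov : ∀ (x : Site d S) (μ : Fin d), ρ (U₀ (x, μ)) * F (x.shift μ) = F x * ρ (U₀ (x, μ))) :
    F = 0 := by
  classical
  -- the one-parameter family of gauge transformations `g_t(x) = ρ⁻¹ exp(t F(x))` fixes `U₀`
  choose g hg using hF
  have hstab : ∀ t : ℝ, gaugeTransform (fun x => g x t) U₀ = U₀ := by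
    intro t
    funext e
    show g e.1 t * U₀ e * (g (e.1.shift e.2) t)⁻¹ = U₀ e
    rw [mul_inv_eq_iff_eq_mul]
    apply hinj
    rw [map_mul, map_mul, hg, hg]
    exact (rho_mul_exp_smul_eq ρ (U₀ e) (hcov e.1 e.2) t).symm
  -- hence `t ↦ exp(t F(x))` takes finitely many values, and `F(x) = 0`
  funext x
  have hFx : Set.Finite ((fun g' : Site d S → G => ρ (g' x)) '' {g' : Site d S → G | gaugeTransform g' U₀ = U₀}) :=
    hfin.image _
  refine eq_zero_of_exp_smul_mem_finite hFx fun t => ?_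
  exact ⟨fun y => g y t, hstab t, hg x t⟩

end Summit.QuantumFields.YangMills.Theorems.TwistExponentGap

end
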